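import Literature.NumberTheory.K2Lit.SiegelEisensteinSeriesDoubled
import HarnessLib

/-!
# Spaces of Siegel sections and holomorphic families of sections on the doubled unitary group

Topic `NumberTheory/K2Lit` (Track B build stream 29; planner `hodgecm-mathlib-K2Liu-plan`; the «standard-section leaf» half of the
tier-0 line writer's re-cut trigger, SIG TABLE rows #7 ∕ #9 of `Cruxes/HLiu418/Lines/K2_Liu_CurveThetaSigs.md`). Definitions and
proved lemmas only: **no `sorry`, no named fact, no instance, no notation.**

Over ★ `K2Lit/SiegelEisensteinSeriesDoubled` (`IsSiegelDeltaSection χ s f`: `f(p h) = χ(det_Δ p)|det_Δ p|^{s+n/2} f(h)` on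
`P_Δ(𝔸) ≤ H(𝔸) = U(𝕍 ⊕ −𝕍)(𝔸)`) this file gives:

* `siegelDeltaSections χ s : Submodule ℂ (H(𝔸) → ℂ)` — the space `I(s, χ)` of (all) Siegel sections, with `add ∕ smul` closure and
  stability under RIGHT translation by `H(𝔸)` (`IsSiegelDeltaSection.rightTranslate` — the group acts on `I(s, χ)` on the right);
* `IsHolomorphicSectionFamily χ f` — an `s`-family of Siegel sections that is ENTIRE in `s` at every `h` (Mathlib `Differentiable ℂ`);
  standard (`K`-flat) families and the Siegel–Weil families `f_Φ^{(s)}` are of this kind — and the `ℂ`-submodule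
  `holomorphicSectionFamilies χ` of them, again right-translation stable.

The two remaining qualifiers of a STANDARD section — `K`-finiteness and flatness of `f_s|_K` in `s` for a fixed maximal compact
`K = ∏_v K_v` with `H(𝔸) = P_Δ(𝔸) K` — need the Iwasawa datum and come with file #7 (Siegel–Weil section) of the DEPMAP table.
References: V. Tan, Canad. J. Math. 51 (1999) §1 [Tan1999]; Y. Liu, Invent. Math. 228 (2022) Lem. B.10 p. 102 [Liu2021];
M. Harris, S. Kudla, W. J. Sweet, JAMS 9 (1996) §1 (1.15)–(1.17) (WANT acq-04821).
-/

noncomputable section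

open NumberField

namespace Literature.NumberTheory.K2Lit.SiegelDoubled

open Literature.NumberTheory.Automorphic Literature.NumberTheory.GaloisRepresentations
open Literature.NumberTheory.GelbartRogawski1991 Literature.NumberTheory.GelbartRogawski1991.GRConstruction

variable (L : Type) [Field L] [NumberField L] [IsCMField L]
variable {N M n : ℕ} (e : Fin N × Fin M ≃ Fin n)
  (dV : Fin N → L) (hdV : ∀ i, IsCMField.complexConj L (dV i) = dV i)
  (dW : Fin M → L) (hdW : ∀ i, IsCMField.complexConj L (dW i) = dW i)

/-! ## 1. `I(s, χ)` as a `ℂ`-subspace of functions on `H(𝔸)`, right-translation stable -/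

variable {L e dV hdV dW hdW} in
/-- Siegel sections are closed under addition. [cite: Tan1999, §1] -/
theorem IsSiegelDeltaSection.add {χ : HeckeCharacter L} {s : ℂ} {f g : HA L e dV hdV dW hdW → ℂ}
    (hf : IsSiegelDeltaSection L e dV hdV dW hdW χ s f) (hg : IsSiegelDeltaSection L e dV hdV dW hdW χ s g) :
    IsSiegelDeltaSection L e dV hdV dW hdW χ s (f + g) := by
  intro p hp h
  rw [Pi.add_apply, Pi.add_apply, hf p hp h, hg p hp h, mul_add]

variable {L e dV hdV dW hdW} in
/-- Siegel sections are closed under scalars. [cite: Tan1999, §1] -/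
theorem IsSiegelDeltaSection.smul {χ : HeckeCharacter L} {s : ℂ} {f : HA L e dV hdV dW hdW → ℂ} (a : ℂ)
    (hf : IsSiegelDeltaSection L e dV hdV dW hdW χ s f) :
    IsSiegelDeltaSection L e dV hdV dW hdW χ s (a • f) := by
  intro p hp h
  rw [Pi.smul_apply, Pi.smul_apply, hf p hp h, smul_eq_mul, smul_eq_mul]
  ring

variable {L e dV hdV dW hdW} in
/-- **`I(s, χ)` is stable under right translation by `H(𝔸)`**: `h ↦ f(h h₀)` is again a Siegel section.
[cite: Tan1999, §1] [cite: Liu2021, Lem. B.10 p. 102] -/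
theorem IsSiegelDeltaSection.rightTranslate {χ : HeckeCharacter L} {s : ℂ} {f : HA L e dV hdV dW hdW → ℂ}
    (hf : IsSiegelDeltaSection L e dV hdV dW hdW χ s f) (h₀ : HA L e dV hdV dW hdW) :
    IsSiegelDeltaSection L e dV hdV dW hdW χ s (fun h => f (h * h₀)) := by
  intro p hp h
  simp only
  rw [mul_assoc, hf p hp (h * h₀)]

/-- **The space `I(s, χ)` of Siegel sections** on `H(𝔸)` (all of them; smooth ∕ `K`-finite ∕ standard ones are subspaces cut
out by the section leaf). [cite: Tan1999, §1] [cite: Liu2021, Lem. B.10 p. 102] -/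
def siegelDeltaSections (χ : HeckeCharacter L) (s : ℂ) : Submodule ℂ (HA L e dV hdV dW hdW → ℂ) where
  carrier := {f | IsSiegelDeltaSection L e dV hdV dW hdW χ s f}
  zero_mem' := fun p _ h => by simp
  add_mem' hf hg := IsSiegelDeltaSection.add hf hg
  smul_mem' a _ hf := IsSiegelDeltaSection.smul a hf

/-- Membership in `I(s, χ)`. [cite: Tan1999, §1] -/
theorem mem_siegelDeltaSections_iff (χ : HeckeCharacter L) (s : ℂ) (f : HA L e dV hdV dW hdW → ℂ) :
    f ∈ siegelDeltaSections L e dV hdV dW hdW χ s ↔ IsSiegelDeltaSection L e dV hdV dW hdW χ s f :=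
  Iff.rfl

/-! ## 2. Holomorphic families of sections -/

/-- **A holomorphic family of Siegel sections**: `f_s ∈ I(s, χ)` for every `s` and `s ↦ f_s(h)` entire for every `h`
(standard sections and Siegel–Weil families `f_Φ^{(s)}` are such). [cite: Tan1999, §1] [cite: Liu2021, Lem. B.10 p. 102] -/
def IsHolomorphicSectionFamily (χ : HeckeCharacter L) (f : ℂ → HA L e dV hdV dW hdW → ℂ) : Prop :=
  IsSiegelDeltaSectionFamily L e dV hdV dW hdW χ f ∧ ∀ h : HA L e dV hdV dW hdW, Differentiable ℂ fun s => f s h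

/-- The zero family is a holomorphic family. [cite: Tan1999, §1] -/
theorem isHolomorphicSectionFamily_zero (χ : HeckeCharacter L) :
    IsHolomorphicSectionFamily L e dV hdV dW hdW χ (fun _ _ => 0) :=
  ⟨fun s => isSiegelDeltaSection_zero L e dV hdV dW hdW χ s, fun _ => differentiable_const 0⟩

variable {L e dV hdV dW hdW} in
/-- Holomorphic families are closed under addition. [cite: Tan1999, §1] -/
theorem IsHolomorphicSectionFamily.add {χ : HeckeCharacter L} {f g : ℂ → HA L e dV hdV dW hdW → ℂ}
    (hf : IsHolomorphicSectionFamily L e dV hdV dW hdW χ f) (hg : IsHolomorphicSectionFamily L e dV hdV dW hdW χ g) :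
    IsHolomorphicSectionFamily L e dV hdV dW hdW χ (f + g) :=
  ⟨fun s => (hf.1 s).add (hg.1 s), fun h => (hf.2 h).add (hg.2 h)⟩

variable {L e dV hdV dW hdW} in
/-- Holomorphic families are closed under scalars. [cite: Tan1999, §1] -/
theorem IsHolomorphicSectionFamily.smul {χ : HeckeCharacter L} {f : ℂ → HA L e dV hdV dW hdW → ℂ} (a : ℂ)
    (hf : IsHolomorphicSectionFamily L e dV hdV dW hdW χ f) :
    IsHolomorphicSectionFamily L e dV hdV dW hdW χ (a • f) :=
  ⟨fun s => (hf.1 s).smul a, fun h => (hf.2 h).const_mul a⟩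

variable {L e dV hdV dW hdW} in
/-- Holomorphic families are stable under right translation by `H(𝔸)`. [cite: Tan1999, §1] -/
theorem IsHolomorphicSectionFamily.rightTranslate {χ : HeckeCharacter L} {f : ℂ → HA L e dV hdV dW hdW → ℂ}
    (hf : IsHolomorphicSectionFamily L e dV hdV dW hdW χ f) (h₀ : HA L e dV hdV dW hdW) :
    IsHolomorphicSectionFamily L e dV hdV dW hdW χ (fun s h => f s (h * h₀)) :=
  ⟨fun s => (hf.1 s).rightTranslate h₀, fun h => hf.2 (h * h₀)⟩

/-- **The space of holomorphic families of Siegel sections.** [cite: Tan1999, §1] -/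
def holomorphicSectionFamilies (χ : HeckeCharacter L) : Submodule ℂ (ℂ → HA L e dV hdV dW hdW → ℂ) where
  carrier := {f | IsHolomorphicSectionFamily L e dV hdV dW hdW χ f}
  zero_mem' := isHolomorphicSectionFamily_zero L e dV hdV dW hdW χ
  add_mem' hf hg := IsHolomorphicSectionFamily.add hf hg
  smul_mem' a _ hf := IsHolomorphicSectionFamily.smul a hf

/-- Membership in the space of holomorphic families. [cite: Tan1999, §1] -/
theorem mem_holomorphicSectionFamilies_iff (χ : HeckeCharacter L) (f : ℂ → HA L e dV hdV dW hdW → ℂ) :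
    f ∈ holomorphicSectionFamilies L e dV hdV dW hdW χ ↔ IsHolomorphicSectionFamily L e dV hdV dW hdW χ f :=
  Iff.rfl

variable {L e dV hdV dW hdW} in
/-- For a holomorphic family, `s ↦ f_s(h)` is in particular continuous. [cite: Tan1999, §1] -/
theorem IsHolomorphicSectionFamily.continuous_apply {χ : HeckeCharacter L} {f : ℂ → HA L e dV hdV dW hdW → ℂ}
    (hf : IsHolomorphicSectionFamily L e dV hdV dW hdW χ f) (h : HA L e dV hdV dW hdW) :
    Continuous fun s => f s h :=
  (hf.2 h).continuous

end Literature.NumberTheory.K2Lit.SiegelDoubled
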